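import Summits.QuantumFields.YangMills.Theorems.BalabanUVNodesN12HVelocityOfClass
import Literature.MathematicalPhysics.QuantumFieldTheory.Balaban1983to89.Node00.MultiScaleFibreChartB
import Literature.MathematicalPhysics.QuantumFieldTheory.Balaban1983to89.Node00.MultiScaleFibreChartLocalityComponentB
import Summits.QuantumFields.YangMills.Theorems.BalabanUVNodesN12DirectSurjHsurjProxiesPrelimB
import Summits.QuantumFields.YangMills.Theorems.BalabanUVNodesN12ForestSliceOfProxiesB
import Summits.QuantumFields.YangMills.Theorems.BalabanUVNodesN12HsurjOfClassLam
import Summits.QuantumFields.YangMills.Theorems.BalabanUVNodesN12MinimiserFamilyAtRecordBjNoPlaqGuardB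
import Summits.QuantumFields.YangMills.Theorems.BalabanUVNodesN12TowerProxiesOfClassB
import HarnessLib

/-!
# BalabanUVNodes ∕ N12 — THE (45) LETTER `hH` IN VELOCITY CURRENCY FOR EVERY (2.12)-CLASS MINIMISER, NO GUARD ON `U₀`: the class-fed producer of the per-base-field row «(45) `hH`, — **BOND-DATUM EDITION** (`…N12HVelocityOfClassB`, USED DECLARATIONS ONLY)

The print-datum ([Balaban1984PropagatorsII] (2.3)) (γ) twin of `Summits/…/Theorems/BalabanUVNodesN12HVelocityOfClass.lean`: the declarations of the parent whose STATEMENT reads the determining datum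
(`hH_velocity_Bj_of_isMinimizer_class`, `hH_velocity_Bj_of_surjective_proxies`, `hasDerivAt_coe_avgFamily_expChart_smul_levelZero`, `hasDerivAt_coe_avgFamily_expChart_smul_of_sharpProxy`) and which N12's junction of record v14ᴸ uses (dag-n12-c g35 probe-2 census `UsedConstsN12RoadTyped2`, THEOREMS block), re-typed over a
BOND-LEVEL datum `𝔅 : BDetSet` (F0a `B15DeterminingSetsB`) and dag-n12-c's bond-datum chart `Node00.msChartB` (✓p774329; `msChart 𝐁 = msChartB (bondsDet 𝐁)` by `rfl`).  GENERATOR twin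
(this seat's `work/g32/gen_thm.py`, block-extracted from the parent's tree bytes): namespace `…N12HVelocityOfClassB`, SAME short names, `DetSet ↦ BDetSet`, `AgreeOn 𝐁 ↦ AgreeOnB 𝔅`,
`IsMinimizer ↦ IsMinimizerB`, `bondsOf (𝐁 j) ↦ 𝔅 j`, `msChart ∕ constrCard ∕ constrEnum ∕ ConstrSet ↦ …B`, NODE 00 chart lemmas `…msChart… ↦ …msChartB…`; proofs VERBATIM; the parent's
datum-free declarations REUSED BY NAME (`open`), never copied (private plumbing excepted, №366 R2).  The parent's (b) statements are the instances `𝔅 := bondsDet 𝐁`.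
ROWS OVER PRINT`s ROWS: the velocity letter (45) is produced per CONSTRAINED ROW OF PRINT`s DATUM `lamBondsSeq (maxDomT M₁ Z) k` (fewer rows than reading (b): no inward connectors); base row `AgreeOnB (lamBondsSeq …) (M˙U₀) W`; `hprox` per PRINT row (this seat`s `towerProxies_lamBondsSeq_of_mem_class`), `hproxSite` unchanged; the forest right inverse from dag-n12-w6`s ✓p780874 `…ForestSliceOfProxiesB.exists_forest_rightInverse_lamBondsSeq_of_surjective_proxies` (roots `R(𝐁,k)` = print`s tower sites); surjectivity of `D(msChartB … (lamBondsSeq …) W U₀)(0)` from dag-n12-w6`s ✓p780422 `…HsurjOfClassLam.surjective_fderiv_msChartB_lamBondsSeq_of_isMinimizerB_class_of_agreeOnB`, whose per-height letter `hHB` is the (b)-LETTER VERBATIM (the one inhabited before `ν` by `N12HsurjOfClass.exists_hsurjLetters`) — so §3 displays `hHB` in (b)-currency unchanged and takes `hmin : IsMinimizerB … 𝔅`` W`` U₀` over ANY bond datum.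
Cell `pub-ymgap` (HUMAN RULINGS D-0062 ∕ D-0149), seat `pub-ymgap-dag-n12-d` g32 (R134 N12 [B15] s2; the (ii) Theorems-side re-key of N12's road at print's [II] (2.3) datum — director-ym №338 ∕
№343 (E1)(iii-b), FLAG №16 ∕ ruling (α); dag-n12-c DESIGN memo a793b2ebc0b803bf (ii); `N12-ROAD-TWIN-ORDER-2026-08-30.md`).  Count-neutral helper of K1⁹ `stmt-QuantumFields-27364`,
`--kind proof --supports … --as helper`.  THEOREMS ONLY (0 `def`, 0 `instance`, 0 `sorry`).

HONEST FRAMING (director-ym №338 (5)).  PURELY ADDITIVE: the parent stays landed and true on its own text; nothing in it is edited; no displayed premise of any consumer is deleted or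
weakened; every hypothesis of the parent stays a hypothesis.  Nothing of Bałaban's analysis asserted; N12 NOT discharged; K0⁷ ∕ K1⁹ NOT closed; counts unmoved (typed 28∕28 · discharged
8∕27, A 8∕28; K 1∕4); one finite 𝕋⁴ programme at fixed ε — R4 closes the conditional rung `BalabanLadder.UV` only; NOT the Yang–Mills mass gap (Clay); nothing continuum ∕ ℝ⁴ ∕ OS.

PARENT's DOCSTRING (the mathematics and the citations; read the site-level `𝐁` as the bond datum `𝔅`):
# BalabanUVNodes ∕ N12 — THE (45) LETTER `hH` IN VELOCITY CURRENCY FOR EVERY (2.12)-CLASS MINIMISER, NO GUARD ON `U₀`: the class-fed producer of the per-base-field row «(45) `hH`,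
# velocity currency» of the lane's tower-guarded (J0′) producer `B15Prop1MinimiserFamilyFromThm1AtBaseCentralTower.…_of_guardOn` (dag-n12-c g24 (M))
# ([Balaban1985Variational] (3)–(4) p. 278, (16)–(18) p. 280, Sect. C (44)–(48) p. 285, (82)–(83) p. 290; [Balaban1985Averaging] (11) p. 19; [Balaban1989LargeFieldII] (1.19) p. 360;
# [Balaban1988Convergent] (2.2) p. 255, (2.10)–(2.13) pp. 256–257)

Cell `pub-ymgap` (HUMAN RULINGS D-0062 ∕ D-0149), WIDTH SEAT `pub-ymgap-dag-n12-w6` g11 (node N12 = [B15]; key K1⁹ `stmt-QuantumFields-27364`, `--kind proof --supports … --as helper`;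
count-neutral).  THEOREMS ONLY (0 `def`, 0 `instance`, 0 `sorry`); by name over this lineage's g11 `N12ForestSliceOfProxies` (p706207) ∕ `N12MinimiserFamilyAtRecordBjNoPlaqGuard` (p707370) ∕
`N12HsurjOfClass` (p705019) and g7 `N12DirectSurjHsurjProxiesPrelim` (p678568), dag-n12-w1's SU(2) chart dictionary `B15Prop1RightInverseFromLinearisedAveraging.expMul_su2Chart_smul_eq_expChart`
and coordinates `B15Prop1RightInverseFromForestLeftField.exists_realCoords_of_lieSUField` ∕ `cplxVec_mem_of_forall_path`, NODE 00's `hasDerivAt_coeField_iter_expChart_smul` ∕ `coe_iter_mul_qLin`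
∕ `fderiv_msChart_apply_levelZero` ∕ `hasDerivAt_coe_expChart_along`, n07-w1's `qLin_mem_lieSU`, the lane's ρ5b p677953 ∕ §3b p679665.

WHY.  After plan g91's (r3) (lane n12-c g24, links (A)–(M)) the (J0′) producer under PER-TOWER guards displays per base field, besides the minimiser, the tower guards (inhabited from the
class by `N12TowerGuardsOfClass`, p704565), (β) and (T1@q₀), the row «(45) `hH` in VELOCITY currency» — dag-n12-w1's letter `∀ τ, ∃ p, cplxVec p ∈ S ∧ ∀ i, HasDerivAt (s ↦ ↑Ū(expMul su2Chart
(s • p) U₀))_{j_i}(c_i)) (↑W_{j_i}(c_i) · Σ_b τ_{i,b} E_b) 0` (the shape of `B15Prop1MinimiserFamilyFromRightInverse.hMin_atRecord_of_rightInverseLetters`, kept VERBATIM by the tower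
producer p707678 with `W = Ū(Q_k^{s*}(ext V_k))`).  Its producer in the tree, `hH_of_dIterL_rightInverse`, reads the GLOBAL guard `SmallBelow k U₀` and a `dIterL`-currency right inverse.  THIS FILE produces it for EVERY (2.12)-class minimiser with NO guard on `U₀`: the slice-valued chart-currency right inverse of
p706207 gives `X` in the forest slice with `DΨ_{𝐁,W,U₀}(0)X = τ′`; `p̂ := Ad(U₀)X` (real `ℝ³`-coordinates `p`) vanishes on the forest and `exp(s p̂)·U₀ = U₀·exp(sX)` (dag-n12-w1's dictionary);
the velocity of the ONE constrained average `Ū^{j}(U₀·exp(sX))(c)` is read at a guarded PROXY agreeing with `U₀` on the sharp tower of `c` (the average's `c`-component is the proxy's,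
`iter_congr_of_twoBlockLocal`), where NODE 00's velocity formula and `coe_iter_mul_qLin` + `qLin ∈ 𝔰𝔲` give the value `↑W_j(c)·↑τ′`; level-`0` rows are the bond itself.

CONTENTS.  §1 ★★ `hasDerivAt_coe_avgFamily_expChart_smul_of_sharpProxy` (velocity of one constrained average along the chart ray at an UNGUARDED base, from one sharp proxy) · ★
`hasDerivAt_coe_avgFamily_expChart_smul_levelZero` (Γ₀ rows).  §2 ★★★ `hH_velocity_Bj_of_surjective_proxies` (p678596's `hprox`∕`hproxSite` shapes + forest + DISPLAYED `hsurj` ⟹ the velocity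
letter).  §3 ★★★ `hH_velocity_Bj_of_isMinimizer_class` (EVERY (2.12)-class minimiser: proxies by ρ5b∕§3b, `hsurj` by p705019; per-height letters `hsbU`∕`hHB` + floors as p705019).

HONEST FRAMING.  Bookkeeping by name + the velocity of one block average; per-height EXISTENCE letters; nothing of Bałaban's estimates asserted or refuted; N12 NOT discharged; K1⁹ NOT closed;
counts of record unmoved; one finite 𝕋⁴ programme at fixed ε — R4 closes only the conditional rung `BalabanLadder.UV`; no summit statement is proved here and NOT the Yang–Mills mass gap (Clay);
nothing continuum ∕ ℝ⁴ ∕ OS.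
-/

noncomputable section

namespace Summit.QuantumFields.YangMills.BalabanUVNodes.N12HVelocityOfClassB

open Literature.MathematicalPhysics.QuantumFieldTheory.Balaban1983to89.B15DeterminingSetsB

open scoped BigOperators Matrix.Norms.L2Operator Topology
open Filter
open Literature.MathematicalPhysics.QuantumFieldTheory.Balaban1983to89
open T4Continuum
open B15DeterminingSets GaugeField
open BlockAveraging (blockAvg)
open ExpMeanLog (expMeanLogSU deltaSU)
open T4AdjointCovarianceUnitary (lieSU expSU specialUnitaryAd coe_specialUnitaryAd specialUnitaryAd_inv_apply)
open Node00
open B15SU2ChartHolomorphic (genE quatMatrix_imQuat)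
open B15Prop1AnalyticExtClause (cplxVec)
open B15Prop1ChartCalculusSU2 (E3)
open T4CubeChartGnomonic (SU2)
open B14.Eq213DetSet (Bj maxDomT Bj_of_gt)
open B14.Eq213MaximalDomains (side)
open B14.Eq216Concrete (feeds)
open B5Eq118OneStroke (iterBlockOf)
open B15Eq112TorusCover (lift)
open T4AxialGaugeSmallField (boxPlaqs)
open T4ReflectionCone (three_le_L)
open T4ReflectionConeSharp (TwoBlockLocal twoBlockLocal_blockAvg)
open B16Sect1Backgrounds (toMS expMul)
open B15Prop1ChartSU2 (su2Chart)
open Summit.QuantumFields.YangMills.BalabanUVNodes.N12DirectSurjSharpDelta2 (iter_congr_of_twoBlockLocal)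
open Summit.QuantumFields.YangMills.BalabanUVNodes.N12DirectSurjHsurjProxiesPrelimB (fderiv_msChart_apply_eq_of_sharpProxy differentiableAt_msChart_of_towerProxies)
open Summit.QuantumFields.YangMills.BalabanUVNodes.N12DirectSurjHsurjPrelim (inner_endpoint_of_mem_bondsOf_Bj)
open Summit.QuantumFields.YangMills.BalabanUVNodes.N12ForestSliceOfProxiesB (exists_forest_rightInverse_lamBondsSeq_of_surjective_proxies)
open Summit.QuantumFields.YangMills.BalabanUVNodes.N12MinimiserFamilyAtRecordBjNoPlaqGuardB (fderiv_msChart_apply_eq_suProj_qLin_of_smallBelow)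
open Summit.QuantumFields.YangMills.BalabanUVNodes.N12HsurjOfClassLam (surjective_fderiv_msChartB_lamBondsSeq_of_isMinimizerB_class_of_agreeOnB)
open Summit.QuantumFields.YangMills.BalabanUVNodes.N12TowerProxiesOfClassB (towerProxies_lamBondsSeq_of_mem_class)
open Summit.QuantumFields.YangMills.BalabanUVNodes.N12SiteProxiesOfClass (siteProxies_Bj_of_mem_class)
open Summit.QuantumFields.YangMills.BalabanUVNodes.N07LinearisedAveragingKernel (qLin_mem_lieSU)
open Literature.MathematicalPhysics.QuantumFieldTheory.Balaban1983to89.B15Prop1RightInverseFromForestLeftField (exists_realCoords_of_lieSUField cplxVec_mem_of_forall_path eq_of_sum_smul_genE_eq)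
open B16Ineq19FlatSliceChart (exists_lieSU2Coord)

section
variable {F : T4Family} {N : ℕ} [NeZero N] {K k : ℕ}

/-- ★★ **VELOCITY OF ONE CONSTRAINED AVERAGE ALONG THE CHART RAY AT AN UNGUARDED BASE, FROM ONE SHARP PROXY.**  `U₀` in the `𝐁`-fibre of `W` with `Ψ_{𝐁,W,U₀}` differentiable at `0`; for
the row `i = (j, c)` a proxy `U′` with the (0.4) guards below `k` agreeing with `U₀` on the sharp tower of `c`; `(DΨ_{𝐁,W,U₀}(0)X)_i = y`.  Then `s ↦ ↑Ū^j(U₀·exp(sX))(c)` has derivative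
`↑W_j(c)·↑y` at `0`: the `c`-component of the average of `U₀·exp(sX)` IS the proxy's (`iter_congr_of_twoBlockLocal`); at the proxy NODE 00's `hasDerivAt_coeField_iter_expChart_smul` gives the
velocity `Q_j(↑U′)[U′·X](c) = ↑Ū^j(U′)(c)·qLin` (`coe_iter_mul_qLin`) with `qLin ∈ 𝔰𝔲(N)` equal to `↑y` by p707370's junction and p678568's component transfer; `Ū^j(U′)(c) = Ū^j(U₀)(c) = W_j(c)`.
[cite: Balaban1985Variational, (3)–(4) p.278, Sect. C (44)–(48) p.285, (82)–(83) p.290; Balaban1988Convergent, (2.10)–(2.11) p.256; Balaban1987RG1, (0.4) p.253, (0.21) p.256] -/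
theorem hasDerivAt_coe_avgFamily_expChart_smul_of_sharpProxy (hk : k ≤ (F.P K).m + (F.P K).K) {𝔅 : BDetSet (F.P K)} {W : MSField (F.P K) (SU N)}
    {U₀ U' : GaugeField (F.P K) 0 (SU N)} (hU : AgreeOnB 𝔅 (avgFamily (avOfRecord F N K) U₀) W) (hΨ : DifferentiableAt ℝ (msChartB F N K k 𝔅 W U₀) 0)
    (hsb' : SmallBelow (avOfRecord F N K) k U') (i : Fin (constrCardB 𝔅 k))
    (hin : ∀ b₀ : PBond (F.P K) 0,
      (iterBlockOf (((constrEnumB 𝔅 k).symm i).1 : ℕ) b₀.src = ((constrEnumB 𝔅 k).symm i).2.1.src ∨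
        iterBlockOf (((constrEnumB 𝔅 k).symm i).1 : ℕ) b₀.src = ((constrEnumB 𝔅 k).symm i).2.1.tgt) →
      (iterBlockOf (((constrEnumB 𝔅 k).symm i).1 : ℕ) b₀.tgt = ((constrEnumB 𝔅 k).symm i).2.1.src ∨
        iterBlockOf (((constrEnumB 𝔅 k).symm i).1 : ℕ) b₀.tgt = ((constrEnumB 𝔅 k).symm i).2.1.tgt) → U' b₀ = U₀ b₀)
    (X : PBond (F.P K) 0 → lieSU (Fin N)) {y : lieSU (Fin N)} (hy : fderiv ℝ (msChartB F N K k 𝔅 W U₀) 0 X i = y) :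
    HasDerivAt (fun s : ℝ => ((avgFamily (avOfRecord F N K) (expChart U₀ (s • X)) ((constrEnumB 𝔅 k).symm i).1 ((constrEnumB 𝔅 k).symm i).2.1 : SU N) :
        Matrix (Fin N) (Fin N) ℂ))
      (((W ((constrEnumB 𝔅 k).symm i).1 ((constrEnumB 𝔅 k).symm i).2.1 : SU N) : Matrix (Fin N) (Fin N) ℂ) * (y : Matrix (Fin N) (Fin N) ℂ)) 0 := by
  set r := (constrEnumB 𝔅 k).symm i with hr
  have hj : (r.1 : ℕ) ≤ k := Nat.lt_succ_iff.1 r.1.2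
  have hjK : (r.1 : ℕ) ≤ (F.P K).m + (F.P K).K := hj.trans hk
  have hsbj : SmallBelow (fun i => blockAvg (P := F.P K) (j := i) (expMeanLogSU (n := Fin N))) (r.1 : ℕ) U' := hsb'.mono hj
  -- (1) the curve's `c`-component is the proxy's
  have hcurve : (fun s : ℝ => ((avgFamily (avOfRecord F N K) (expChart U₀ (s • X)) r.1 r.2.1 : SU N) : Matrix (Fin N) (Fin N) ℂ)) =
      fun s : ℝ => ((avgFamily (avOfRecord F N K) (expChart U' (s • X)) r.1 r.2.1 : SU N) : Matrix (Fin N) (Fin N) ℂ) := by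
    funext s
    have e : avgFamily (avOfRecord F N K) (expChart U₀ (s • X)) r.1 r.2.1 = avgFamily (avOfRecord F N K) (expChart U' (s • X)) r.1 r.2.1 :=
      iter_congr_of_twoBlockLocal (avOfRecord F N K) (fun _ => twoBlockLocal_blockAvg _) _ hjK _ _ _ fun b₀ hs ht => by
        show U₀ b₀ * expSU ((s • X) b₀) = U' b₀ * expSU ((s • X) b₀)
        rw [hin b₀ hs ht]
    rw [e]
  -- (2) the velocity at the proxy
  have hvel : HasDerivAt (fun s : ℝ => ((avgFamily (avOfRecord F N K) (expChart U' (s • X)) r.1 r.2.1 : SU N) : Matrix (Fin N) (Fin N) ℂ))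
      (dIterL (r.1 : ℕ) (coeField U') (fun b => (U' b : Matrix (Fin N) (Fin N) ℂ) * (X b : Matrix (Fin N) (Fin N) ℂ)) r.2.1) 0 :=
    (hasDerivAt_pi.1 (hasDerivAt_coeField_iter_expChart_smul hsbj X)) r.2.1
  -- (3) the value: `qLin = ↑y` and `Ū^j(U′)(c) = W_j(c)`
  have hq : qLin (r.1 : ℕ) U' X r.2.1 = (y : Matrix (Fin N) (Fin N) ℂ) := by
    have h1 : suProj N (qLin (r.1 : ℕ) U' X r.2.1) = y := by
      rw [← fderiv_msChart_apply_eq_suProj_qLin_of_smallBelow hsb' 𝔅 X i, ← fderiv_msChart_apply_eq_of_sharpProxy hk hU hΨ hsb' i hin X, hy]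
    rw [← h1, coe_suProj_of_mem (qLin_mem_lieSU hsbj X _)]
  have hW' : ((Averaging.iter (fun i => blockAvg (P := F.P K) (j := i) (expMeanLogSU (n := Fin N))) (r.1 : ℕ) U' r.2.1 : SU N) : Matrix (Fin N) (Fin N) ℂ) =
      ((W r.1 r.2.1 : SU N) : Matrix (Fin N) (Fin N) ℂ) := by
    have e : avgFamily (avOfRecord F N K) U' r.1 r.2.1 = avgFamily (avOfRecord F N K) U₀ r.1 r.2.1 :=
      iter_congr_of_twoBlockLocal (avOfRecord F N K) (fun _ => twoBlockLocal_blockAvg _) _ hjK _ _ _ fun b₀ hs ht => hin b₀ hs ht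
    have e' : avgFamily (avOfRecord F N K) U' r.1 r.2.1 = W r.1 r.2.1 := by rw [e]; exact hU _ _ r.2.2
    exact congrArg Subtype.val e'
  have hval : dIterL (r.1 : ℕ) (coeField U') (fun b => (U' b : Matrix (Fin N) (Fin N) ℂ) * (X b : Matrix (Fin N) (Fin N) ℂ)) r.2.1 =
      ((W r.1 r.2.1 : SU N) : Matrix (Fin N) (Fin N) ℂ) * (y : Matrix (Fin N) (Fin N) ℂ) := by
    rw [← coe_iter_mul_qLin hsbj X r.2.1, hq, hW']
  rw [hcurve]
  rw [hval] at hvel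
  exact hvel

end

section
variable {F : T4Family} {N : ℕ} [NeZero N] {K k : ℕ}

/-- ★ **VELOCITY AT A `Γ₀` ROW** (level `0`: the «average» is the bond itself): for `c ∈ bondsOf (𝐁 0)` and `(DΨ_{𝐁,W,U₀}(0)X)_{(0,c)} = y`, `s ↦ ↑(U₀·exp(sX))(c)` has derivative `↑W_0(c)·↑y` at
`0` — `(DΨ(0)X)_{(0,c)} = X_c` (`fderiv_msChartB_apply_levelZero`) and `W_0(c) = U₀(c)` on the fibre; no proxy. [cite: Balaban1988Convergent, (2.2) p.255, (2.10)–(2.11) p.256; Balaban1985RegularSpaces, (1.10) p.77] -/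
theorem hasDerivAt_coe_avgFamily_expChart_smul_levelZero {𝔅 : BDetSet (F.P K)} {W : MSField (F.P K) (SU N)} {U₀ : GaugeField (F.P K) 0 (SU N)}
    (hU : AgreeOnB 𝔅 (avgFamily (avOfRecord F N K) U₀) W) (hΨ : DifferentiableAt ℝ (msChartB F N K k 𝔅 W U₀) 0)
    (c : PBond (F.P K) 0) (hc : c ∈ (𝔅 0)) (X : PBond (F.P K) 0 → lieSU (Fin N)) {y : lieSU (Fin N)}
    (hy : fderiv ℝ (msChartB F N K k 𝔅 W U₀) 0 X (constrEnumB 𝔅 k ⟨⟨0, Nat.succ_pos k⟩, c, hc⟩) = y) :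
    HasDerivAt (fun s : ℝ => ((avgFamily (avOfRecord F N K) (expChart U₀ (s • X)) 0 c : SU N) : Matrix (Fin N) (Fin N) ℂ))
      (((W 0 c : SU N) : Matrix (Fin N) (Fin N) ℂ) * (y : Matrix (Fin N) (Fin N) ℂ)) 0 := by
  have hyc : y = X c := by rw [← hy, fderiv_msChartB_apply_levelZero hU hΨ c hc X]
  have hW0 : W 0 c = U₀ c := (hU 0 c hc).symm
  have h := hasDerivAt_coe_expChart_along (U := U₀) (c := fun t : ℝ => t • X) (hasDerivAt_ray X) (zero_smul ℝ X) c
  rw [hyc, hW0]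
  exact h

end

section
variable {F : T4Family} {K k : ℕ}

/-- ★★★ **THE (45) LETTER `hH` IN VELOCITY CURRENCY AT AN UNGUARDED BASE, FROM THE (P4)′ PROXY LETTERS** — dag-n12-w1's per-base-field binder `hH` of
`B15Prop1MinimiserFamilyFromRightInverse.hMin_atRecord_of_rightInverseLetters` (and of the lane's tower twin (M)) VERBATIM for a general datum `W` with `U₀` in its `𝐁_k(Z)`-fibre: for every
target `τ` a REAL slice field `p` (`cplxVec p ∈ S`, `S` the axial slice (F3) of a rooted forest with (F1) and roots ⊇ `R(𝐁_k(Z), k)`) such that every constrained average of `exp(s p̂)·U₀` has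
velocity `↑W_{j_i}(c_i)·(Σ_b τ_{i,b} E_b)` at `s = 0`.  Construction: `X := H τ′` from p706207's slice-valued right inverse (`τ′ := φ ∘ τ`, `φ` the `𝔰𝔲(2)` coordinates), `p̂ := Ad(U₀)X`
(real coordinates by `exists_realCoords_of_lieSUField`; vanishes on the forest), `exp(s p̂)·U₀ = U₀·exp(sX)` (dag-n12-w1's dictionary), and §1 per row (sharp proxies from `hproxSite` at an
inner end-point; level-`0` rows by `…_levelZero`).  Displayed: p678596's `hprox`∕`hproxSite` shapes and the surjectivity of `DΨ_{𝐁_k(Z),W,U₀}(0)`.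
[cite: Balaban1985Variational, (3)–(4) p.278, (16)–(18) p.280, Sect. C (44)–(48) p.285, (82)–(83) p.290; Balaban1989LargeFieldII, (1.19) p.360; Balaban1985RegularSpaces, (1.19) p.79; Balaban1988Convergent, (2.2) p.255, (2.10)–(2.13) pp.256–257] -/
theorem hH_velocity_lamBondsSeq_of_surjective_proxies {M₁ : ℕ} {Z : Set (Site (F.P K) 0)} (hk : k ≤ (F.P K).m + (F.P K).K)
    {W : MSField (F.P K) SU2} {U₀ : GaugeField (F.P K) 0 SU2} (hU : AgreeOnB (lamBondsSeq (maxDomT M₁ Z) k) (avgFamily (avOfRecord F 2 K) U₀) W)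
    (hprox : ∀ i : Fin (constrCardB (lamBondsSeq (maxDomT M₁ Z) k) k), ∃ U' : GaugeField (F.P K) 0 SU2,
      (∀ b ∈ feeds (((constrEnumB (lamBondsSeq (maxDomT M₁ Z) k) k).symm i).1 : ℕ) ((constrEnumB (lamBondsSeq (maxDomT M₁ Z) k) k).symm i).2.1, U' b = U₀ b) ∧ SmallBelow (avOfRecord F 2 K) k U')
    (hproxSite : ∀ (j : ℕ), 1 ≤ j → j ≤ k → ∀ y : Site (F.P K) j, embIter j y ∈ maxDomT M₁ Z j → ∃ U' : GaugeField (F.P K) 0 SU2,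
      (∀ c : PBond (F.P K) j, (c.src = y ∨ c.tgt = y) → ∀ b₀ : PBond (F.P K) 0,
        (iterBlockOf j b₀.src = c.src ∨ iterBlockOf j b₀.src = c.tgt) → (iterBlockOf j b₀.tgt = c.src ∨ iterBlockOf j b₀.tgt = c.tgt) → U' b₀ = U₀ b₀) ∧
      SmallBelow (avOfRecord F 2 K) k U')
    (S : Submodule ℂ (VecField (F.P K) 0 (EuclideanSpace ℂ (Fin 3))))
    {path : Site (F.P K) 0 → List (LStep (F.P K) 0)}
    (hroot : ∀ r ∈ {z : Site (F.P K) 0 | ∃ j, j ≤ k ∧ ∃ c ∈ ((lamBondsSeq (maxDomT M₁ Z) k : BDetSet (F.P K)) j), (z = embIter j c.src ∨ z = embIter j c.tgt)}, path r = [])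
    (hF1 : ∀ x, ∀ s ∈ path x, ∃ x' x'' : Site (F.P K) 0, path x'' = path x' ++ [s] ∧
      (s.fwd = true → s.bond.src = x' ∧ s.bond.tgt = x'') ∧ (s.fwd = false → s.bond.src = x'' ∧ s.bond.tgt = x'))
    (hF3 : ∀ X : VecField (F.P K) 0 (EuclideanSpace ℂ (Fin 3)), X ∈ S ↔ ∀ x, ∀ s ∈ path x, X s.bond = 0)
    (hsurj : Function.Surjective (fderiv ℝ (msChartB F 2 K k (lamBondsSeq (maxDomT M₁ Z) k) W U₀) 0)) :
    ∀ τ : Fin (constrCardB (lamBondsSeq (maxDomT M₁ Z) k) k) → EuclideanSpace ℝ (Fin 3), ∃ p : VecField (F.P K) 0 E3, cplxVec p ∈ S ∧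
      ∀ i : Fin (constrCardB (lamBondsSeq (maxDomT M₁ Z) k) k), HasDerivAt (fun s : ℝ => ((avgFamily (avOfRecord F 2 K) (expMul su2Chart (s • p) U₀)
        ((constrEnumB (lamBondsSeq (maxDomT M₁ Z) k) k).symm i).1 ((constrEnumB (lamBondsSeq (maxDomT M₁ Z) k) k).symm i).2.1 : SU2) : Matrix (Fin 2) (Fin 2) ℂ))
        (((W ((constrEnumB (lamBondsSeq (maxDomT M₁ Z) k) k).symm i).1 ((constrEnumB (lamBondsSeq (maxDomT M₁ Z) k) k).symm i).2.1 : SU2) : Matrix (Fin 2) (Fin 2) ℂ) *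
          ∑ b : Fin 3, ((τ i b : ℝ) : ℂ) • genE b) 0 := by
  intro τ
  obtain ⟨φ, hφ⟩ := exists_lieSU2Coord
  obtain ⟨H, hHS, hH⟩ := exists_forest_rightInverse_lamBondsSeq_of_surjective_proxies hk hU hprox hproxSite hroot hF1 hsurj
  have hΨ : DifferentiableAt ℝ (msChartB F 2 K k (lamBondsSeq (maxDomT M₁ Z) k) W U₀) 0 := differentiableAt_msChart_of_towerProxies hk hU hprox
  set τ' : Fin (constrCardB (lamBondsSeq (maxDomT M₁ Z) k) k) → lieSU (Fin 2) := fun i => φ (τ i) with hτ'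
  set X : PBond (F.P K) 0 → lieSU (Fin 2) := H τ' with hX
  -- the left field `p̂ := Ad(U₀)X` in real coordinates
  obtain ⟨p, hp⟩ := exists_realCoords_of_lieSUField (fun b => specialUnitaryAd (U₀ b) (X b))
  have hp0 : ∀ x, ∀ s ∈ path x, p s.bond = 0 := fun x s hs => by
    have h := hp s.bond
    have hX0 : X s.bond = 0 := hHS τ' x s hs
    rw [hX0, map_zero, Submodule.coe_zero] at h
    have h0 : (∑ a : Fin 3, (((0 : EuclideanSpace ℝ (Fin 3)) a : ℝ) : ℂ) • genE a) = 0 := by simp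
    exact eq_of_sum_smul_genE_eq (h.trans h0.symm)
  refine ⟨p, cplxVec_mem_of_forall_path S path hF3 hp0, fun i => ?_⟩
  -- the dictionary: `exp(s p̂)·U₀ = U₀·exp(sX)`
  have hφp : ∀ b, φ (p b) = specialUnitaryAd (U₀ b) (X b) := fun b => Subtype.ext (by rw [hφ, quatMatrix_imQuat]; exact hp b)
  have hF : (fun b => specialUnitaryAd (U₀ b)⁻¹ (φ (p b))) = X := funext fun b => by rw [hφp b, specialUnitaryAd_inv_apply]
  have hfun : (fun s : ℝ => ((avgFamily (avOfRecord F 2 K) (expMul su2Chart (s • p) U₀)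
        ((constrEnumB (lamBondsSeq (maxDomT M₁ Z) k) k).symm i).1 ((constrEnumB (lamBondsSeq (maxDomT M₁ Z) k) k).symm i).2.1 : SU2) : Matrix (Fin 2) (Fin 2) ℂ)) =
      fun s : ℝ => ((avgFamily (avOfRecord F 2 K) (expChart U₀ (s • X))
        ((constrEnumB (lamBondsSeq (maxDomT M₁ Z) k) k).symm i).1 ((constrEnumB (lamBondsSeq (maxDomT M₁ Z) k) k).symm i).2.1 : SU2) : Matrix (Fin 2) (Fin 2) ℂ) := by
    funext s
    rw [expMul_su2Chart_smul_eq_expChart hφ p U₀ s, hF]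
  have hτi : ((τ' i : lieSU (Fin 2)) : Matrix (Fin 2) (Fin 2) ℂ) = ∑ b : Fin 3, ((τ i b : ℝ) : ℂ) • genE b := by
    rw [hτ']; dsimp only; rw [hφ, quatMatrix_imQuat]
  have hyi : fderiv ℝ (msChartB F 2 K k (lamBondsSeq (maxDomT M₁ Z) k) W U₀) 0 X i = τ' i := by rw [hX, hH τ']
  rw [hfun, ← hτi]
  -- per row: a `Γ₀` row, or a positive-level row read at a sharp proxy from an inner end-point
  rcases Nat.eq_zero_or_pos (((constrEnumB (lamBondsSeq (maxDomT M₁ Z) k) k).symm i).1 : ℕ) with h0 | hpos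
  · -- a `Γ₀` row: name the row `r = (0, c)` and read the bond itself
    generalize hy' : τ' i = y at hyi ⊢
    rw [← (constrEnumB (lamBondsSeq (maxDomT M₁ Z) k) k).apply_symm_apply i] at hyi
    generalize hr : (constrEnumB (lamBondsSeq (maxDomT M₁ Z) k) k).symm i = r at hyi h0 ⊢
    obtain ⟨⟨j, hj⟩, c, hc⟩ := r
    obtain rfl : j = 0 := h0
    exact hasDerivAt_coe_avgFamily_expChart_smul_levelZero hU hΨ c hc X hyi
  · have hjk : (((constrEnumB (lamBondsSeq (maxDomT M₁ Z) k) k).symm i).1 : ℕ) ≤ k := Nat.le_of_lt_succ ((constrEnumB (lamBondsSeq (maxDomT M₁ Z) k) k).symm i).1.isLt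
    have hc : ((constrEnumB (lamBondsSeq (maxDomT M₁ Z) k) k).symm i).2.1 ∈ bondsOf ((Bj M₁ Z k : DetSet (F.P K)) ((constrEnumB (lamBondsSeq (maxDomT M₁ Z) k) k).symm i).1) :=
      (lamBondsSeq_subset_bondsOf_genSet _ _ _ ((constrEnumB (lamBondsSeq (maxDomT M₁ Z) k) k).symm i).2.2)
    rcases inner_endpoint_of_mem_bondsOf_Bj hpos hjk hc with hy | hy
    · obtain ⟨U', hag, hsb'⟩ := hproxSite _ hpos hjk _ hy
      exact hasDerivAt_coe_avgFamily_expChart_smul_of_sharpProxy hk hU hΨ hsb' i (hag _ (Or.inl rfl)) X hyi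
    · obtain ⟨U', hag, hsb'⟩ := hproxSite _ hpos hjk _ hy
      exact hasDerivAt_coe_avgFamily_expChart_smul_of_sharpProxy hk hU hΨ hsb' i (hag _ (Or.inr rfl)) X hyi

end

section
variable {F : T4Family} {k : ℕ}

/-- ★★★ **THE (45) LETTER `hH` IN VELOCITY CURRENCY FOR EVERY (2.12)-CLASS MINIMISER — NO GUARD ON `U₀`, NO NEAR-FLATNESS**: the per-base-field row «(45) `hH`, velocity currency» of the
lane's tower-guarded (J0′) producer (`B15Prop1MinimiserFamilyFromThm1AtBaseCentralTower.…_of_guardOn`, dag-n12-c g24 (M); text of dag-n12-w1's `hMin_atRecord_of_rightInverseLetters`) for a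
minimiser `U₀` of ANY constrained problem over `regMSCoPOfRecord F 2 ν Kt k (maxDomT ν.M₁ Z)` (only membership is read), any datum `W` with `U₀` in its `𝐁_k(Z)`-fibre, any rooted forest
with (F1), roots ⊇ `R(𝐁_k(Z), k)` and axial slice `S` (F3).  §2 fed by the class: proxies by ρ5b `towerProxies_lamBondsSeq_of_mem_class` ∕ §3b `siteProxies_Bj_of_mem_class`, surjectivity by
`N12HsurjOfClass` (p705019).  Displayed: the per-HEIGHT letters `hsbU` (ρ″), `hHB` (εH, B) + floors `6(d−1)L·εreg ≤ ρ″`, `εreg ≤ εH` (inhabited before `ν` by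
`N12HsurjOfClass.exists_hsurjLetters`), numerics `k+1 ≤ m+K`, `4L ≤ M₁`, `0 ≤ εreg`, `LᵏM₁ ∣ N₀`.
[cite: Balaban1985Variational, (3)–(4) p.278, (16)–(18) p.280, Sect. C (44)–(48) p.285, (82)–(83) p.290; Balaban1989LargeFieldII, (1.19) p.360; Balaban1985RegularSpaces, (1.19) p.79; Balaban1988Convergent, (2.2) p.255, (2.10)–(2.13) pp.256–257; Balaban1987RG1, (0.4) p.253] -/
theorem hH_velocity_lamBondsSeq_of_isMinimizer_class (ν : Node00.Stage7Numerics) (Kt : ℕ) (Z : Set (Site (F.P Kt) 0))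
    (hkK : k + 1 ≤ (F.P Kt).m + (F.P Kt).K) (hM4 : 4 * (F.P Kt).L ≤ ν.M₁) (hdiv : side (F.P Kt).L ν.M₁ k ∣ (F.P Kt).sitesPerDir 0) (hε : 0 ≤ ν.εreg)
    {ρ'' : ℝ} (hsbU : ∀ V : GaugeField (F.P Kt) 0 SU2, ‖coeField V - 1‖ ≤ ρ'' → SmallBelow (avOfRecord F 2 Kt) k V)
    (hερ : 6 * ((((F.P Kt).d - 1 : ℕ)) : ℝ) * (F.P Kt).L * ν.εreg ≤ ρ'')
    {εH B : ℝ}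
    (hHB : ∀ (Wd : MSField (F.P Kt) SU2) (U₀ : GaugeField (F.P Kt) 0 SU2),
      AgreeOn (Bj ν.M₁ Z k) (avgFamily (avOfRecord F 2 Kt) U₀) Wd →
      (∀ i' : Fin (constrCard (Bj ν.M₁ Z k) k), ∃ U' : GaugeField (F.P Kt) 0 SU2,
        (∀ b ∈ feeds (((constrEnum (Bj ν.M₁ Z k) k).symm i').1 : ℕ) ((constrEnum (Bj ν.M₁ Z k) k).symm i').2.1, U' b = U₀ b) ∧
          SmallBelow (avOfRecord F 2 Kt) k U') →
      (∀ (j : ℕ), 1 ≤ j → j ≤ k → ∀ y : Site (F.P Kt) j, embIter j y ∈ maxDomT ν.M₁ Z j → ∃ U' : GaugeField (F.P Kt) 0 SU2,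
        (∀ c : PBond (F.P Kt) j, (c.src = y ∨ c.tgt = y) → ∀ b₀ : PBond (F.P Kt) 0,
          (iterBlockOf j b₀.src = c.src ∨ iterBlockOf j b₀.src = c.tgt) → (iterBlockOf j b₀.tgt = c.src ∨ iterBlockOf j b₀.tgt = c.tgt) → U' b₀ = U₀ b₀) ∧
        SmallBelow (avOfRecord F 2 Kt) k U') →
      (∀ (j : ℕ), 1 ≤ j → j ≤ k → ∀ y : Site (F.P Kt) j, embIter j y ∈ maxDomT ν.M₁ Z j →
        PlaqSmallOn (boxPlaqs (fun κ => lift (F.P Kt) (embIter j y) κ - ((((F.P Kt).L ^ j : ℕ) : ℤ) + ((((F.P Kt).L ^ j - 1) / 2 : ℕ) : ℤ)))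
          (fun κ => lift (F.P Kt) (embIter j y) κ + ((((F.P Kt).L ^ j : ℕ) : ℤ) + ((((F.P Kt).L ^ j - 1) / 2 : ℕ) : ℤ))) : Set (Plaq (F.P Kt) 0)) εH U₀) →
      ∃ H : (Fin (constrCard (Bj ν.M₁ Z k) k) → lieSU (Fin 2)) → PBond (F.P Kt) 0 → lieSU (Fin 2),
        (∀ v, fderiv ℝ (msChart F 2 Kt k (Bj ν.M₁ Z k) Wd U₀) 0 (H v) = v) ∧ ∀ v, Real.sqrt (∑ b, ‖H v b‖ ^ 2) ≤ B * ‖v‖)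
    (hεH : ν.εreg ≤ εH)
    {𝔅' : BDetSet (F.P Kt)} {W' : MSField (F.P Kt) SU2} {U₀ : GaugeField (F.P Kt) 0 SU2}
    (hmin : IsMinimizerB (avOfRecord F 2 Kt) (regMSCoPOfRecord F 2 ν Kt k (maxDomT ν.M₁ Z)) 𝔅' W' U₀)
    {W : MSField (F.P Kt) SU2} (hW : AgreeOnB (lamBondsSeq (maxDomT ν.M₁ Z) k) (avgFamily (avOfRecord F 2 Kt) U₀) W)
    (S : Submodule ℂ (VecField (F.P Kt) 0 (EuclideanSpace ℂ (Fin 3))))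
    {path : Site (F.P Kt) 0 → List (LStep (F.P Kt) 0)}
    (hroot : ∀ r ∈ {z : Site (F.P Kt) 0 | ∃ j, j ≤ k ∧ ∃ c ∈ ((lamBondsSeq (maxDomT ν.M₁ Z) k : BDetSet (F.P Kt)) j), (z = embIter j c.src ∨ z = embIter j c.tgt)}, path r = [])
    (hF1 : ∀ x, ∀ s ∈ path x, ∃ x' x'' : Site (F.P Kt) 0, path x'' = path x' ++ [s] ∧
      (s.fwd = true → s.bond.src = x' ∧ s.bond.tgt = x'') ∧ (s.fwd = false → s.bond.src = x'' ∧ s.bond.tgt = x'))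
    (hF3 : ∀ X : VecField (F.P Kt) 0 (EuclideanSpace ℂ (Fin 3)), X ∈ S ↔ ∀ x, ∀ s ∈ path x, X s.bond = 0) :
    ∀ τ : Fin (constrCardB (lamBondsSeq (maxDomT ν.M₁ Z) k) k) → EuclideanSpace ℝ (Fin 3), ∃ p : VecField (F.P Kt) 0 E3, cplxVec p ∈ S ∧
      ∀ i : Fin (constrCardB (lamBondsSeq (maxDomT ν.M₁ Z) k) k), HasDerivAt (fun s : ℝ => ((avgFamily (avOfRecord F 2 Kt) (expMul su2Chart (s • p) U₀)
        ((constrEnumB (lamBondsSeq (maxDomT ν.M₁ Z) k) k).symm i).1 ((constrEnumB (lamBondsSeq (maxDomT ν.M₁ Z) k) k).symm i).2.1 : SU2) : Matrix (Fin 2) (Fin 2) ℂ))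
        (((W ((constrEnumB (lamBondsSeq (maxDomT ν.M₁ Z) k) k).symm i).1 ((constrEnumB (lamBondsSeq (maxDomT ν.M₁ Z) k) k).symm i).2.1 : SU2) : Matrix (Fin 2) (Fin 2) ℂ) *
          ∑ b : Fin 3, ((τ i b : ℝ) : ℂ) • genE b) 0 :=
  hH_velocity_lamBondsSeq_of_surjective_proxies (Nat.le_of_succ_le hkK) hW
    (towerProxies_lamBondsSeq_of_mem_class ν Kt Z hkK hM4 hdiv hε hsbU hερ hmin.1)
    (siteProxies_Bj_of_mem_class ν Kt Z hkK hM4 hdiv hε hsbU hερ hmin.1) S hroot hF1 hF3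
    (surjective_fderiv_msChartB_lamBondsSeq_of_isMinimizerB_class_of_agreeOnB ν Kt Z hkK hM4 hdiv hε hsbU hερ hHB hεH hmin hW)

end

end Summit.QuantumFields.YangMills.BalabanUVNodes.N12HVelocityOfClassB

end
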